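import Literature.MathematicalPhysics.QuantumFieldTheory.Balaban1983to89.Node00.Record12BgRowTopClass
import Literature.MathematicalPhysics.QuantumFieldTheory.Balaban1983to89.Node00.LargeFieldBackgroundCoPOfRecord

/-!
# NODE 00 — ROW P11 UNDER F7, v1.5 `CoP`: the top-domain [15] fact AT THE SUPPORT OF RECORD — `VariationalThm1RegSepCoP7` — and the row's suppliers at node00-def-R's
# collar-class minimiser `UbgMSCoPOfRecord … s 𝐖` (FILE 22′ `Node00.LargeFieldBackgroundCoPOfRecord`): the `bg` supplier of RECORD 13 v1.5 `Record13SepCoP`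

Cell `pub-ymgap`, seat `pub-ymgap-node00-def-P11` g3 (R218).  director-ym №160 (F7-b∕F7-c) ∕ №162 ((y) FINAL, EDITION FREEZE v1.5 `CoP`); node00-def-R SCOPE WORD D1–D9 (INBOX
l.18343): `seqTop`, `suppDomOfRecord` ([III] p.255's support = `Ω₁` + one layer of `M₁`-cubes), `regMSCoPOfRecord(At)` (print's class (2) = (1.7) ∧ (1.9) with scale 0 on the support),
`bgMSCoPOfRecord(At)`, `UbgMSCoPOfRecord(At)` (OLD ARITY), faces `isMinimizer_UbgMSCoPOfRecord`, `UbgMSCoPOfRecord_eq_one_of_not_mem`.  This file only INSTANTIATES FILE 12b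
(`VariationalThm1RegSepTop7`, `plaqSmallOn_∕coDivSmallOn_of_thm1RegSepTop7`, `bgRowAtDatumU_of_thm1RegSepTop7C1`) at the selector `Sup := suppDomOfRecord` and at def-R's faces
— FILE 12b's class literal IS `regMSCoPOfRecord … s.Ω` with `εreg` for `ε₀`, by `rfl` (FILE 12a put the `if` inside `plaqsOf`∕`bondsOf` as `seqTop` does).  NO `h9`; the (1.9)
member at the minimiser is a class property (def-R `coDivSmallOn_UbgMSCoPOfRecord`).

CONTENTS.  ★★ `VariationalThm1RegSepCoP7 F N B₃ a₀ a₁` (def := the top-domain fact at `suppDomOfRecord`; the citeable token of the v1.5 `bg` road; NEVER asserted), `.of_le`,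
`.toTop7` ∕ `VariationalThm1RegSepTop7.toCoP7` (`Iff.rfl`-level bridges); `plaqSmallOn_UbgMSCoPOfRecord_of_thm1RegSepCoP7`, `coDivSmallOn_UbgMSCoPOfRecord_of_thm1RegSepCoP7`,
★★★ `bgRowAtDatumCoP_of_thm1RegSepCoP7C1` — ROW P11's body at `(s, 𝐖)` for `UbgMSCoPOfRecord … s 𝐖` (on the solvable set FILE 12b's generic theorem at `isMinimizer_UbgMSCoPOfRecord`,
off it the junk `1` by FILE 10's `bgRowAtDatum_one`).

HONEST FRAMING.  Application only + one `def` (a specialisation of FILE 12b's named fact, never asserted); nothing of Bałaban asserted or discharged; K0⁗ NOT closed; counts unmoved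
(typed 28∕28 · discharged 5∕28); one finite `𝕋⁴` torus family at fixed `ε = L^{−K}`; not continuum ∕ OS ∕ mass gap ∕ Clay.  No `instance`, no `sorry`.
-/

noncomputable section

open MeasureTheory
open scoped Matrix.Norms.L2Operator

namespace Literature.MathematicalPhysics.QuantumFieldTheory.Balaban1983to89.Node00

open T4Continuum B14.Eq218Concrete B15DeterminingSets B12RegularSpaces111 B14RegularSpaces234 B14Radii T4AxialGaugeSmallField

/-! ## §1  The top-domain fact AT THE SUPPORT OF RECORD — the citeable token -/

section NamedFactCoP

variable (F : T4Family) (N : ℕ) [NeZero N]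

/-- **★★ NAMED FACT, v1.5 `CoP` EDITION — [15] THEOREM 1, (R)-READING, OVER PRINT'S CLASS (6) OF CONFIGURATIONS ON THE SUPPORT OF RECORD `suppDomOfRecord` ([III] p.255: `Ω₁` + one
layer of `M₁`-cubes), TWO-SIDED COMPARABILITY**: FILE 12b's `VariationalThm1RegSepTop7` at the selector `Sup := suppDomOfRecord` — so its class literal is node00-def-R's
`regMSCoPOfRecord F N ν K k s.Ω` (with `ε₀` for `εreg`) by `rfl`, its data clause is `Sect2.DataSmall7PTop … (suppDomOfRecord …) …`, and its conclusion (8) reads scale `0` on the support.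
A `Prop` with parameters, NEVER asserted; the token plan's rev-20 V9 stub 1 cites under v1.5.  Inhabitation floor displayed by consumers: `2L² ≤ B₃`.
-- TODO(general form): ONE threshold ε₁ in print; general admissible `{Ω_j}`∕`𝔅_k` ([6] Sect. A) and print's separation letter `R ≥ R₁`; orbit uniqueness and (9)–(10) are not part of this sentence.
[cite: Balaban1985Variational, (1) p.277, Thm 1 (2),(3),(5),(6),(7)–(8) pp.278–279; Balaban1985RegularSpaces, (1.7)–(1.9) p.77; Balaban1988Convergent, p.255, (2.6)–(2.8) pp.255–256, (2.12) p.256] -/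
def VariationalThm1RegSepCoP7 (B₃ a₀ a₁ : ℝ) : Prop :=
  VariationalThm1RegSepTop7 F N (fun ν K Ω => suppDomOfRecord F ν K Ω) B₃ a₀ a₁

variable {F N}

/-- The `CoP` fact IS the top-domain fact at the support selector of record (definitional). [cite: Balaban1985Variational, Thm 1 (8) p.279 (bookkeeping)] -/
theorem VariationalThm1RegSepCoP7.toTop7 {B₃ a₀ a₁ : ℝ} (h : VariationalThm1RegSepCoP7 F N B₃ a₀ a₁) :
    VariationalThm1RegSepTop7 F N (fun ν K Ω => suppDomOfRecord F ν K Ω) B₃ a₀ a₁ := h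

/-- Conversely (definitional). [cite: Balaban1985Variational, Thm 1 (8) p.279 (bookkeeping)] -/
theorem VariationalThm1RegSepTop7.toCoP7 {B₃ a₀ a₁ : ℝ} (h : VariationalThm1RegSepTop7 F N (fun ν K Ω => suppDomOfRecord F ν K Ω) B₃ a₀ a₁) :
    VariationalThm1RegSepCoP7 F N B₃ a₀ a₁ := h

/-- The `CoP` fact is ANTITONE in `a₀`, `a₁`. [cite: Balaban1985Variational, Thm 1 p.279 (the range «ε₀ ≤ a₀», «ε₁ ≤ a₁»)] -/
theorem VariationalThm1RegSepCoP7.of_le {B₃ a₀ a₀' a₁ a₁' : ℝ} (h : VariationalThm1RegSepCoP7 F N B₃ a₀ a₁) (ha₀ : a₀' ≤ a₀) (ha₁ : a₁' ≤ a₁) :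
    VariationalThm1RegSepCoP7 F N B₃ a₀' a₁' :=
  VariationalThm1RegSepTop7.of_le h ha₀ ha₁

end NamedFactCoP

/-! ## §2  The suppliers AT def-R's collar-class minimiser `UbgMSCoPOfRecord … s 𝐖` — the v1.5 `bg` supplier -/

section AtRecordCoP

variable {F : T4Family} {N : ℕ} [NeZero N]

/-- **★ def-R's COLLAR-CLASS BACKGROUND `UbgMSCoPOfRecord … s 𝐖` IS `B₃·cR·ε_n`-REGULAR AT EVERY SCALE ON THE SOLVABLE SET** (plaquette half of (8); scale 0 on the support), from the
`CoP` fact, for a separated sequence, thresholds comparable both ways and a datum with print's (7) on the support (`h7`).  def-R's `isMinimizer_UbgMSCoPOfRecord` elaborates at FILE 12b's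
class literal by `rfl`. [cite: Balaban1985Variational, Thm 1 (2),(6)–(8) pp.278–279; Balaban1988Convergent, (2.6)–(2.8) pp.255–256, (2.12) p.256] -/
theorem plaqSmallOn_UbgMSCoPOfRecord_of_thm1RegSepCoP7 {B₃ a₀ a₁ : ℝ} (h15 : VariationalThm1RegSepCoP7 F N B₃ a₀ a₁) (ν : Stage7Numerics) (M : ℕ)
    (g : ℕ → ℝ) (K k : ℕ) (cR : ℝ) (s : SeqOfRecord F ν M g K k) (hsep : Sect2.SeqSeparated ν.M₁ s)
    (hnum : ∀ n, n ≤ k → 0 < cR * epsOfRecord ν g n ∧ cR * epsOfRecord ν g n ≤ a₁ ∧ B₃ * (cR * epsOfRecord ν g n) ≤ ν.εreg) (ha₀ : ν.εreg ≤ a₀)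
    (hcomp : ∀ n, n < k → cR * epsOfRecord ν g n ≤ 2 * (cR * epsOfRecord ν g (n + 1)))
    (hcomp' : ∀ n, n < k → cR * epsOfRecord ν g (n + 1) ≤ 2 * (cR * epsOfRecord ν g n))
    {W : MSField (F.P K) (SU N)} (h7 : Sect2.DataSmall7PTop (avOfRecord F N K) s.Ω (suppDomOfRecord F ν K s.Ω) k (fun n => cR * epsOfRecord ν g n) W)
    (hsol : W ∈ solvableDom (avOfRecord F N K) (regMSCoPOfRecord F N ν K k s.Ω) (genSet s.Ω k)) :
    ∀ n, n ≤ k → PlaqSmallOn (Sect2.omegaPlaqsTop s.Ω (suppDomOfRecord F ν K s.Ω) n) (B₃ * (cR * epsOfRecord ν g n) * (F.P K).eta n ^ 2) (UbgMSCoPOfRecord F N ν M g K k s W) :=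
  plaqSmallOn_of_thm1RegSepTop7 h15 ν M g K k cR s hsep hnum ha₀ hcomp hcomp' h7 (isMinimizer_UbgMSCoPOfRecord ν M g K k s hsol)

/-- The co-divergence half of (8) at def-R's collar-class background on the solvable set (scale 0 on the support), from the `CoP` fact. [cite: Balaban1985Variational, Thm 1 (8) p.279; Balaban1985RegularSpaces, (1.9) p.77] -/
theorem coDivSmallOn_UbgMSCoPOfRecord_of_thm1RegSepCoP7 {B₃ a₀ a₁ : ℝ} (h15 : VariationalThm1RegSepCoP7 F N B₃ a₀ a₁) (ν : Stage7Numerics) (M : ℕ)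
    (g : ℕ → ℝ) (K k : ℕ) (cR : ℝ) (s : SeqOfRecord F ν M g K k) (hsep : Sect2.SeqSeparated ν.M₁ s)
    (hnum : ∀ n, n ≤ k → 0 < cR * epsOfRecord ν g n ∧ cR * epsOfRecord ν g n ≤ a₁ ∧ B₃ * (cR * epsOfRecord ν g n) ≤ ν.εreg) (ha₀ : ν.εreg ≤ a₀)
    (hcomp : ∀ n, n < k → cR * epsOfRecord ν g n ≤ 2 * (cR * epsOfRecord ν g (n + 1)))
    (hcomp' : ∀ n, n < k → cR * epsOfRecord ν g (n + 1) ≤ 2 * (cR * epsOfRecord ν g n))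
    {W : MSField (F.P K) (SU N)} (h7 : Sect2.DataSmall7PTop (avOfRecord F N K) s.Ω (suppDomOfRecord F ν K s.Ω) k (fun n => cR * epsOfRecord ν g n) W)
    (hsol : W ∈ solvableDom (avOfRecord F N K) (regMSCoPOfRecord F N ν K k s.Ω) (genSet s.Ω k)) :
    ∀ n, n ≤ k → Sect2.CoDivSmallOn (Sect2.omegaBondsTop s.Ω (suppDomOfRecord F ν K s.Ω) n) (B₃ * (cR * epsOfRecord ν g n) * (F.P K).eta n ^ 3) (UbgMSCoPOfRecord F N ν M g K k s W) :=
  coDivSmallOn_of_thm1RegSepTop7 h15 ν M g K k cR s hsep hnum ha₀ hcomp hcomp' h7 (isMinimizer_UbgMSCoPOfRecord ν M g K k s hsol)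

/-- **★★★ ROW P11's BODY AT `(s, 𝐖)` FOR def-R's COLLAR-CLASS MINIMISER `UbgMSCoPOfRecord … s 𝐖`, FROM THE `CoP` FACT** — the v1.5 `Record13SepCoP` `bg` row's supplier: on the
solvable set FILE 12b's `bgRowAtDatumU_of_thm1RegSepTop7C1` at `isMinimizer_UbgMSCoPOfRecord`, off it the junk `1` by FILE 10's `bgRowAtDatum_one`.  Hypotheses: the `CoP` fact, print's
(7) on the datum over the support (`h7 : Sect2.DataSmall7PTop …`), the displayed C¹ class clause for the minimiser on the solvable set ([15] Thm 1 (9)–(10), gauge-free reading), the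
numerics∕letters of FILE 11's ★★★ theorem, `hcomp` AND `hcomp'` — and NO `h9`.
[cite: Balaban1985Variational, Thm 1 (2),(6)–(10) pp.278–279; Balaban1988Convergent, p.255, (2.6)–(2.8) pp.255–256, (2.12) p.256, (2.27)–(2.28) p.259, (2.34)–(2.41) p.261; Balaban1987RG1, (1.11)–(1.16) p.262] -/
theorem bgRowAtDatumCoP_of_thm1RegSepCoP7C1 {B₃ B₃' a₀ a₁ tI tMS : ℝ} (h15 : VariationalThm1RegSepCoP7 F N B₃ a₀ a₁)
    (S : Sect2.Setting (MatA N) (SU N)) (hι : S.ι = ιSU N) (h𝓜 : S.𝓜 = B12RegularSpaces111SpecialUnitary.suModel N) (hS : S.Laws) (hpos : S.Pos)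
    (ν : Stage7Numerics) {M : ℕ} (hM : 0 < M) (K k : ℕ) (cR : ℝ) (hB₃ : 0 ≤ B₃) (hB₃' : 0 ≤ B₃')
    (hg : ∀ j, 1 ≤ j → j ≤ k → 0 < S.flow.g j ∧ S.flow.g j ^ 2 ≤ Real.exp (-1)) (hpq : ν.p₀ ≤ S.lf.q₀)
    (hnum : ∀ n, n ≤ k → 0 < cR * epsOfRecord ν S.flow.g n ∧ cR * epsOfRecord ν S.flow.g n ≤ a₁ ∧ B₃ * (cR * epsOfRecord ν S.flow.g n) ≤ ν.εreg)
    (ha₀ : ν.εreg ≤ a₀) (hcomp : ∀ n, n < k → cR * epsOfRecord ν S.flow.g n ≤ 2 * (cR * epsOfRecord ν S.flow.g (n + 1)))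
    (hcomp' : ∀ n, n < k → cR * epsOfRecord ν S.flow.g (n + 1) ≤ 2 * (cR * epsOfRecord ν S.flow.g n))
    (hα : ∀ n, 1 ≤ n → n ≤ k → 0 < S.lf.alpha0 (S.flow.g n) ∧ 0 < S.lf.alpha1 (S.flow.g n))
    (hBα : ∀ n, 1 ≤ n → n ≤ k → B₃ * (cR * epsOfRecord ν S.flow.g n) ≤ (1 - S.βc) * S.lf.alpha0 (S.flow.g n))
    (hΛI0 : 0 ≤ (4 * (B₃ + (((F.P K).d - 1 : ℕ) : ℝ) * (((F.P K).L : ℝ) * M) * B₃') + 16 * ((((F.P K).d - 1 : ℕ) : ℝ) * (((F.P K).L : ℝ) * M)) ^ 2 * B₃ ^ 2 * a₁) * cR * ν.A₀)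
    (hΛI : (4 * (B₃ + (((F.P K).d - 1 : ℕ) : ℝ) * (((F.P K).L : ℝ) * M) * B₃') + 16 * ((((F.P K).d - 1 : ℕ) : ℝ) * (((F.P K).L : ℝ) * M)) ^ 2 * B₃ ^ 2 * a₁) * cR * ν.A₀ ≤
      tI * S.lf.C₀) (htI : tI < S.cB)
    (hΛMS0 : 0 ≤ (4 * (B₃ + (((F.P K).d - 1 : ℕ) : ℝ) * (M : ℝ) * B₃') + 16 * ((((F.P K).d - 1 : ℕ) : ℝ) * (M : ℝ)) ^ 2 * B₃ ^ 2 * a₁) * cR * ν.A₀)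
    (hΛMS : (4 * (B₃ + (((F.P K).d - 1 : ℕ) : ℝ) * (M : ℝ) * B₃') + 16 * ((((F.P K).d - 1 : ℕ) : ℝ) * (M : ℝ)) ^ 2 * B₃ ^ 2 * a₁) * cR * ν.A₀ ≤ tMS * S.lf.C₀)
    (htMS : tMS < S.B * S.C * S.Mr)
    (hsN : ∀ n, 1 ≤ n → n ≤ k + 1 → ((B14.Eq213MaximalDomains.side (F.P K).L M n : ℕ) : ℤ) < (F.P K).sitesPerDir 0)
    (hcB : 2 * (((F.P K).d - 1 : ℕ) : ℝ) * ((F.P K).L * M) < S.cB) (hBCM : 2 * (((F.P K).d - 1 : ℕ) : ℝ) * M < S.B * S.C * S.Mr)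
    (hsmallI : ∀ j, 1 ≤ j → j ≤ k → (((F.P K).d - 1 : ℕ) : ℝ) * ((F.P K).L * M) * (F.P K).eta j * (B₃ * (cR * epsOfRecord ν S.flow.g j)) ≤ 1 / 2)
    (hsmallMS : ∀ n, 1 ≤ n → n ≤ k → (((F.P K).d - 1 : ℕ) : ℝ) * M * (F.P K).eta n * (B₃ * (cR * epsOfRecord ν S.flow.g n)) ≤ 1 / 2)
    (hC1 : ∀ j, 1 ≤ j → j ≤ k → ∃ t : ℕ, 0 < t ∧ RkOfRecord (F.P K).L ν.r (S.flow.g j) = (F.P K).L * t)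
    (hC2 : ∀ j, 1 ≤ j → j ≤ k → dCubeSide (F.P K).L M (RkOfRecord (F.P K).L ν.r (S.flow.g j)) j ∣ (F.P K).sitesPerDir 0)
    (s : SeqOfRecord F ν M S.flow.g K k) (hsep : Sect2.SeqSeparated ν.M₁ s) (W : MSField (F.P K) (SU N))
    (h7 : Sect2.DataSmall7PTop (avOfRecord F N K) s.Ω (suppDomOfRecord F ν K s.Ω) k (fun n => cR * epsOfRecord ν S.flow.g n) W)
    (hclassC1 : W ∈ solvableDom (avOfRecord F N K) (regMSCoPOfRecord F N ν K k s.Ω) (genSet s.Ω k) →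
      ∀ n, 1 ≤ n → n ≤ k → PlaqC1SmallOn (plaqInside (s.Ω n)) (B₃' * (cR * epsOfRecord ν S.flow.g n) * (F.P K).eta n ^ 3) (UbgMSCoPOfRecord F N ν M S.flow.g K k s W)) :
    ∀ j, 1 ≤ j → j ≤ k → ∀ X : (Sect2.domSys (F.P K) M j).Dom,
      (Sect2.domSites (F.P K) M j X ⊆ s.Λ j →
        Sect2.ofBackgroundC S.ι (UbgMSCoPOfRecord F N ν M S.flow.g K k s W) ∈
          Sect2.spaceI S (Sect2.Residual.unit (F.P K) (MatA N)) M j (Sect2.domSites (F.P K) M j X) (S.lf.alpha0 (S.flow.g j)) (S.lf.alpha1 (S.flow.g j))) ∧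
      (Sect2.admB (F.P K) ν M S.flow.g s.Ω s.Λ j (Sect2.domSites (F.P K) M j X) = true →
        Sect2.ofBackgroundC S.ι (UbgMSCoPOfRecord F N ν M S.flow.g K k s W) ∈
          Sect2.spaceMS S (Sect2.Residual.unit (F.P K) (MatA N)) M j (Sect2.domSites (F.P K) M j X) s.Ω) := by
  by_cases hsol : W ∈ solvableDom (avOfRecord F N K) (regMSCoPOfRecord F N ν K k s.Ω) (genSet s.Ω k)
  · exact bgRowAtDatumU_of_thm1RegSepTop7C1 h15 S hι h𝓜 hS hpos ν hM K k cR hB₃ hB₃' hg hpq hnum ha₀ hcomp hcomp' hα hBα hΛI0 hΛI htI hΛMS0 hΛMS htMS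
      hsN hcB hBCM hsmallI hsmallMS hC1 hC2 s hsep h7 (isMinimizer_UbgMSCoPOfRecord ν M S.flow.g K k s hsol) (hclassC1 hsol)
  · rw [UbgMSCoPOfRecord_eq_one_of_not_mem ν M S.flow.g K k s hsol]
    exact bgRowAtDatum_one S hpos ν M K k s hα

end AtRecordCoP

end Literature.MathematicalPhysics.QuantumFieldTheory.Balaban1983to89.Node00

end
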